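import Summits.CriticalPhenomena.Ising3DConformalLimit.Theorems.EnergyNotSigmaSquaredMoebiusLimitExistsPedigreeStepAux
import HarnessLib

/-!
# Mirror pedigrees V: the continuum recursion step `pedigreeStep`
(stub `pedigreeStep` of line `only-interaction-breaks-moebius`, crux `MoebiusLimitExists`,
item stmt-CriticalPhenomena-1344, route `EnergyNotSigmaSquared`; registered 2026-08-16)

The REFLECTION-POSITIVITY TRANSFER at the level of clusters: along a mesh sequence `u k → 0⁺`, on a
compact `K` of non-coincident `(a+b)`-point configurations all cut by one cubic mirror
`{rdotZ g · = T}` with margin `κ` (kept cluster `A` = first `a` indices, discarded block `B` = last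
`b`), single-variable asymptotic equicontinuity of the pinned `(a+b)`-point critical zoom at a kept
index follows from (i) single-variable asymptotic equicontinuity of the `(a+a)`-point zoom at the same
index on a closed thickening of the doubled configurations `A ∪ θA` and (ii) an eventual bound of the
`(b+b)`-point zoom on a closed thickening of the doubled blocks `θB ∪ B` — via the lattice CLUSTER
MOVE INEQUALITY (the statement of the landed `clusterMoveIneq_cubic`, taken as a hypothesis) at the
lattice mirror `latticeMirror g ⌊T/u k⌋`, multiplied by `ρ_pin^{2(a+b)}`. The `O(u k)` discrepancy
between lattice-reflected blocks and the lattice approximations of reflected blocks is absorbed by the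
thickenings (helpers `…PedigreeStepAux.lean`). With the landed `pedigree_assembly` (induction on
pedigree depth), `pedigree_cover ∘ covering_all` (every configuration has a pedigree) and the base
case `sepMove_equicontinuity`, this closes the line's residue `stub_equicontinuity_inner`.

References: J. Fröhlich, R. Israel, E. H. Lieb, B. Simon, Comm. Math. Phys. 62 (1978) §2 (site
mirrors); H. Duminil-Copin, ICM 2022 §8.1 (the pinned zoom); the recursion is the standing
disprover's (Cruxes/MoebiusLimitExists/Disproof.lean §G.1′, `PedigreeStep`). No definitions.
-/

noncomputable section

open Filter Topology Set Function Metric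
open Literature.Probability.LatticeModels

namespace Summit.CriticalPhenomena.Ising3DConformalLimit.MoebiusLimitExistsOnlyInteraction

/-- `natAdd a j ≠ castAdd b i` in `Fin (a + b)` (the blocks are disjoint). [folklore] -/
theorem natAdd_ne_castAdd_ps {a b : ℕ} (j : Fin b) (i : Fin a) : Fin.natAdd a j ≠ Fin.castAdd b i := by
  intro h
  have h' := congrArg Fin.val h
  simp only [Fin.val_natAdd, Fin.val_castAdd] at h'
  omega

/-- **STUB `pedigreeStep` — THE CONTINUUM RECURSION STEP fed by the cluster move inequality (line
`only-interaction-breaks-moebius`, skeleton v4; registered 2026-08-16).** Along a mesh sequence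
`u k → 0⁺`, on a compact `K` of non-coincident `(a+b)`-configurations all cut by the SAME cubic mirror
`{rdotZ g · = T}` with margin `κ` (cluster `A` = first `a` indices below, block `B` = last `b` indices
above): if the pinned `(b+b)`-zoom is eventually bounded by `M` on the closed `η₀`-thickening of the
doubled `B`-configurations and the pinned `(a+a)`-zoom is single-variable asymptotically equicontinuous
at the index `castAdd a i₀` on the closed `η₀`-thickening of the doubled `A`-configurations, then the
pinned `(a+b)`-zoom is single-variable asymptotically equicontinuous at `castAdd b i₀` on `K`. The first
hypothesis is the statement of `clusterMoveIneq_cubic` (landed). Proof: at mesh `δ = u k` take the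
lattice mirror `Θ = latticeMirror g ⌊T/δ⌋`; for `4δ ≤ κ` the lattice approximations of `x, x' ∈ K`
satisfy the side conditions of the cluster inequality (`zdot_latticeApprox_le_floor_ps`,
`floor_le_zdot_latticeApprox_ps`), which multiplied by `ρ_pin(δ)^{2(a+b)}` reads
`(F x − F x')² ≤ [(F Z₁ − F Z₂) − (F Z₃ − F Z₄)] · F Z_B` for the lifts `Z₁ = δ(Y_A ++ ΘY_A)`,
`Z₂ = δ(Y'_A ++ ΘY_A)`, `Z₃ = δ(Y_A ++ ΘY'_A)`, `Z₄ = δ(Y'_A ++ ΘY'_A)`, `Z_B = δ(ΘY_B ++ Y_B)` (the middle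
Gram entry is rewritten once by `Θ`-invariance, involutivity and a block swap, so that both pairs
differ only at the kept index `castAdd a i₀`); the lifts are within `22δ + dist x x'` of
`doubledA g T x` / `doubledB g T x` (`dist_liftA_doubledA_le_ps`, `dist_liftB_doubledB_le_ps`), hence in
the `η₀`-thickenings, and the pairs are within `4δ + dist x x'` of each other (`dist_liftA_liftA_le_ps`),
so the bracket is `< 2ε₁` by the `SVEquicont` hypothesis and `|F Z_B| ≤ M`; with
`ε₁ = ε²/(2|M| + 2)` this gives `|F x − F x'| < ε`. [cite: FILS1978, §2]
[cite: DuminilCopinICM2022, §8.1 eq. (8.1)–(8.2)] -/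
theorem pedigreeStep :
    (∀ (g : Site 3), IsCubicDir g → ∀ (c : ℤ),
      (∀ (n : ℕ) (y : Fin n → Site 3), criticalCorr 3 n (latticeMirror g c ∘ y) = criticalCorr 3 n y) ∧
      ∀ (a b : ℕ) (i : Fin a) (yA yA' : Fin a → Site 3) (yB : Fin b → Site 3),
        (∀ j, j ≠ i → yA' j = yA j) → (∀ j, zdot g (yA j) ≤ c) → zdot g (yA' i) ≤ c →
        (∀ j, c ≤ zdot g (yB j)) →
        (criticalCorr 3 (a + b) (Fin.append yA yB) - criticalCorr 3 (a + b) (Fin.append yA' yB)) ^ 2 ≤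
          (criticalCorr 3 (a + a) (Fin.append yA (latticeMirror g c ∘ yA))
            - 2 * criticalCorr 3 (a + a) (Fin.append yA (latticeMirror g c ∘ yA'))
            + criticalCorr 3 (a + a) (Fin.append yA' (latticeMirror g c ∘ yA'))) *
          criticalCorr 3 (b + b) (Fin.append (latticeMirror g c ∘ yB) yB)) →
    ∀ u : ℕ → ℝ, Tendsto u atTop (𝓝[>] (0 : ℝ)) →
      ∀ (a b : ℕ) (i₀ : Fin a) (g : Site 3), IsCubicDir g → ∀ (T κ η₀ M : ℝ), 0 < κ → 0 < η₀ →
        ∀ K : Set (Fin (a + b) → EuclideanSpace ℝ (Fin 3)), IsCompact K → K ⊆ NonCoincident 3 (a + b) →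
          (∀ x ∈ K, (∀ j : Fin a, rdotZ g (x (Fin.castAdd b j)) + κ ≤ T) ∧
            (∀ j : Fin b, T + κ ≤ rdotZ g (x (Fin.natAdd a j)))) →
          (∀ᶠ k in atTop, ∀ z ∈ Metric.cthickening η₀ (doubledB g T '' K),
            |rescaledCorrelator (criticalCorr 3) rhoPin (b + b) (u k) z| ≤ M) →
          SVEquicont u (a + a) (Metric.cthickening η₀ (doubledA g T '' K)) (Fin.castAdd a i₀) →
          SVEquicont u (a + b) K (Fin.castAdd b i₀) := by
  intro hCM u hu a b i₀ g hg T κ η₀ M hκ hη₀ K _hK _hKs hcut hLB hSV ε hε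
  have hupos : ∀ᶠ k in atTop, 0 < u k := (tendsto_nhdsWithin_iff.1 hu).2
  have hu0 : Tendsto u atTop (𝓝 0) := (tendsto_nhdsWithin_iff.1 hu).1
  -- the modulus of the `(a+a)`-zoom for `ε₁ = ε²/(2|M|+2)`
  set ε₁ : ℝ := ε ^ 2 / (2 * |M| + 2) with hε₁
  have hε₁pos : 0 < ε₁ := by positivity
  obtain ⟨η₁, hη₁, hE₁⟩ := hSV ε₁ hε₁pos
  -- small meshes
  have hsmall : ∀ᶠ k in atTop, u k < min (κ / 4) (min (η₁ / 8) (η₀ / 44)) :=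
    hu0.eventually (gt_mem_nhds (by positivity))
  refine ⟨min (η₁ / 2) (η₀ / 2), by positivity, ?_⟩
  filter_upwards [hE₁, hLB, hupos, hsmall] with k hE₁k hLBk hpos hsm x hx x' hx' hdiff hdist
  -- the mesh and its smallness
  set δ : ℝ := u k with hδ
  have hsm₁ : δ < κ / 4 := lt_of_lt_of_le hsm (min_le_left _ _)
  have hsm₂ : δ < η₁ / 8 := lt_of_lt_of_le hsm ((min_le_right _ _).trans (min_le_left _ _))
  have hsm₃ : δ < η₀ / 44 := lt_of_lt_of_le hsm ((min_le_right _ _).trans (min_le_right _ _))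
  have hδκ : 4 * δ ≤ κ := by linarith
  have hdist₁ : dist x x' < η₁ / 2 := lt_of_lt_of_le hdist (min_le_left _ _)
  have hdist₀ : dist x x' < η₀ / 2 := lt_of_lt_of_le hdist (min_le_right _ _)
  have hdist' : dist x' x < η₀ / 2 := by rwa [dist_comm]
  -- lattice data at mesh `δ`
  set c : ℤ := ⌊T / δ⌋ with hc
  set yA : Fin a → Site 3 := fun j => latticeApprox δ (x (Fin.castAdd b j)) with hyA
  set yA' : Fin a → Site 3 := fun j => latticeApprox δ (x' (Fin.castAdd b j)) with hyA'
  set yB : Fin b → Site 3 := fun j => latticeApprox δ (x (Fin.natAdd a j)) with hyB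
  have hy : (fun l => latticeApprox δ (x l)) = Fin.append yA yB :=
    (Fin.append_castAdd_natAdd (f := fun l => latticeApprox δ (x l))).symm
  have hy' : (fun l => latticeApprox δ (x' l)) = Fin.append yA' yB := by
    rw [← Fin.append_castAdd_natAdd (f := fun l => latticeApprox δ (x' l))]
    congr 1
    funext j
    show latticeApprox δ (x' (Fin.natAdd a j)) = latticeApprox δ (x (Fin.natAdd a j))
    rw [hdiff _ (natAdd_ne_castAdd_ps j i₀)]
  -- lattice side conditions of the cluster move inequality
  have hsA : ∀ j, zdot g (yA j) ≤ c := fun j =>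
    zdot_latticeApprox_le_floor_ps hg hpos hδκ ((hcut x hx).1 j)
  have hsA' : zdot g (yA' i₀) ≤ c := zdot_latticeApprox_le_floor_ps hg hpos hδκ ((hcut x' hx').1 i₀)
  have hsB : ∀ j, c ≤ zdot g (yB j) := fun j =>
    floor_le_zdot_latticeApprox_ps hg hpos hδκ ((hcut x hx).2 j)
  have hdiffA : ∀ j, j ≠ i₀ → yA' j = yA j := fun j hj => by
    show latticeApprox δ (x' (Fin.castAdd b j)) = latticeApprox δ (x (Fin.castAdd b j))
    rw [hdiff _ fun h => hj (Fin.castAdd_inj.1 h)]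
  obtain ⟨hinvar, hineq⟩ := hCM g hg c
  have hCI := hineq a b i₀ yA yA' yB hdiffA hsA hsA' hsB
  -- the middle Gram entry, rewritten: `G(Y_A ++ ΘY'_A) = G(Y'_A ++ ΘY_A)`
  have hmid : criticalCorr 3 (a + a) (Fin.append yA (latticeMirror g c ∘ yA')) =
      criticalCorr 3 (a + a) (Fin.append yA' (latticeMirror g c ∘ yA)) := by
    have h1 := hinvar (a + a) (Fin.append yA (latticeMirror g c ∘ yA'))
    rw [comp_append] at h1
    have hΘΘ : latticeMirror g c ∘ (latticeMirror g c ∘ yA') = yA' :=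
      funext fun j => latticeMirror_latticeMirror_cm hg c (yA' j)
    rw [hΘΘ] at h1
    rw [← h1, criticalCorr_append_comm]
  -- the lifts
  set Z₁ : Fin (a + a) → EuclideanSpace ℝ (Fin 3) :=
    fun j => δ • siteVec (Fin.append yA (latticeMirror g c ∘ yA) j) with hZ₁
  set Z₂ : Fin (a + a) → EuclideanSpace ℝ (Fin 3) :=
    fun j => δ • siteVec (Fin.append yA' (latticeMirror g c ∘ yA) j) with hZ₂
  set Z₃ : Fin (a + a) → EuclideanSpace ℝ (Fin 3) :=
    fun j => δ • siteVec (Fin.append yA (latticeMirror g c ∘ yA') j) with hZ₃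
  set Z₄ : Fin (a + a) → EuclideanSpace ℝ (Fin 3) :=
    fun j => δ • siteVec (Fin.append yA' (latticeMirror g c ∘ yA') j) with hZ₄
  set ZB : Fin (b + b) → EuclideanSpace ℝ (Fin 3) :=
    fun j => δ • siteVec (Fin.append (latticeMirror g c ∘ yB) yB j) with hZB
  -- the zooms at the lifts and at `x`, `x'`
  have hFx : rescaledCorrelator (criticalCorr 3) rhoPin (a + b) δ x =
      rhoPin δ ^ (a + b) * criticalCorr 3 (a + b) (Fin.append yA yB) := by
    rw [rescaledCorrelator_apply, hy]
  have hFx' : rescaledCorrelator (criticalCorr 3) rhoPin (a + b) δ x' =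
      rhoPin δ ^ (a + b) * criticalCorr 3 (a + b) (Fin.append yA' yB) := by
    rw [rescaledCorrelator_apply, hy']
  have hF₁ : rescaledCorrelator (criticalCorr 3) rhoPin (a + a) δ Z₁ =
      rhoPin δ ^ (a + a) * criticalCorr 3 (a + a) (Fin.append yA (latticeMirror g c ∘ yA)) :=
    rescaledCorrelator_lift_ps hpos _
  have hF₂ : rescaledCorrelator (criticalCorr 3) rhoPin (a + a) δ Z₂ =
      rhoPin δ ^ (a + a) * criticalCorr 3 (a + a) (Fin.append yA (latticeMirror g c ∘ yA')) := by
    rw [hmid]; exact rescaledCorrelator_lift_ps hpos _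
  have hF₃ : rescaledCorrelator (criticalCorr 3) rhoPin (a + a) δ Z₃ =
      rhoPin δ ^ (a + a) * criticalCorr 3 (a + a) (Fin.append yA (latticeMirror g c ∘ yA')) :=
    rescaledCorrelator_lift_ps hpos _
  have hF₄ : rescaledCorrelator (criticalCorr 3) rhoPin (a + a) δ Z₄ =
      rhoPin δ ^ (a + a) * criticalCorr 3 (a + a) (Fin.append yA' (latticeMirror g c ∘ yA')) :=
    rescaledCorrelator_lift_ps hpos _
  have hFB : rescaledCorrelator (criticalCorr 3) rhoPin (b + b) δ ZB =
      rhoPin δ ^ (b + b) * criticalCorr 3 (b + b) (Fin.append (latticeMirror g c ∘ yB) yB) :=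
    rescaledCorrelator_lift_ps hpos _
  -- the cluster inequality at scale
  have key : (rescaledCorrelator (criticalCorr 3) rhoPin (a + b) δ x -
        rescaledCorrelator (criticalCorr 3) rhoPin (a + b) δ x') ^ 2 ≤
      ((rescaledCorrelator (criticalCorr 3) rhoPin (a + a) δ Z₁ -
          rescaledCorrelator (criticalCorr 3) rhoPin (a + a) δ Z₂) -
        (rescaledCorrelator (criticalCorr 3) rhoPin (a + a) δ Z₃ -
          rescaledCorrelator (criticalCorr 3) rhoPin (a + a) δ Z₄)) *
      rescaledCorrelator (criticalCorr 3) rhoPin (b + b) δ ZB := by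
    rw [hFx, hFx', hF₁, hF₂, hF₃, hF₄, hFB]
    have hρ : 0 ≤ rhoPin δ ^ (a + b) * rhoPin δ ^ (a + b) := mul_self_nonneg _
    calc (rhoPin δ ^ (a + b) * criticalCorr 3 (a + b) (Fin.append yA yB) -
          rhoPin δ ^ (a + b) * criticalCorr 3 (a + b) (Fin.append yA' yB)) ^ 2
        = rhoPin δ ^ (a + b) * rhoPin δ ^ (a + b) *
          (criticalCorr 3 (a + b) (Fin.append yA yB) - criticalCorr 3 (a + b) (Fin.append yA' yB)) ^ 2 := by
          ring
      _ ≤ rhoPin δ ^ (a + b) * rhoPin δ ^ (a + b) *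
          ((criticalCorr 3 (a + a) (Fin.append yA (latticeMirror g c ∘ yA))
            - 2 * criticalCorr 3 (a + a) (Fin.append yA (latticeMirror g c ∘ yA'))
            + criticalCorr 3 (a + a) (Fin.append yA' (latticeMirror g c ∘ yA'))) *
          criticalCorr 3 (b + b) (Fin.append (latticeMirror g c ∘ yB) yB)) :=
          mul_le_mul_of_nonneg_left hCI hρ
      _ = _ := by ring
  -- membership of the lifts in the thickenings
  have hxK : doubledA g T x ∈ doubledA g T '' K := mem_image_of_mem _ hx
  have hxKB : doubledB g T x ∈ doubledB g T '' K := mem_image_of_mem _ hx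
  have hm₁ : Z₁ ∈ Metric.cthickening η₀ (doubledA g T '' K) := by
    refine Metric.mem_cthickening_of_dist_le _ _ _ _ hxK ?_
    refine (dist_liftA_doubledA_le_ps hg hpos T x x x).trans ?_
    rw [dist_self, max_self]; linarith
  have hm₂ : Z₂ ∈ Metric.cthickening η₀ (doubledA g T '' K) := by
    refine Metric.mem_cthickening_of_dist_le _ _ _ _ hxK ?_
    refine (dist_liftA_doubledA_le_ps hg hpos T x' x x).trans ?_
    rw [dist_self, max_eq_left dist_nonneg]; linarith
  have hm₃ : Z₃ ∈ Metric.cthickening η₀ (doubledA g T '' K) := by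
    refine Metric.mem_cthickening_of_dist_le _ _ _ _ hxK ?_
    refine (dist_liftA_doubledA_le_ps hg hpos T x x' x).trans ?_
    rw [dist_self, max_eq_right dist_nonneg]; linarith
  have hm₄ : Z₄ ∈ Metric.cthickening η₀ (doubledA g T '' K) := by
    refine Metric.mem_cthickening_of_dist_le _ _ _ _ hxK ?_
    refine (dist_liftA_doubledA_le_ps hg hpos T x' x' x).trans ?_
    rw [max_self]; linarith
  have hmB : ZB ∈ Metric.cthickening η₀ (doubledB g T '' K) := by
    refine Metric.mem_cthickening_of_dist_le _ _ _ _ hxKB ?_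
    refine (dist_liftB_doubledB_le_ps hg hpos T x).trans ?_
    linarith
  -- the two single moves of the kept index and the bounded block
  have hBr₁ : |rescaledCorrelator (criticalCorr 3) rhoPin (a + a) δ Z₁ -
      rescaledCorrelator (criticalCorr 3) rhoPin (a + a) δ Z₂| < ε₁ := by
    refine hE₁k Z₁ hm₁ Z₂ hm₂ (liftA_eq_of_ne_ps g δ c hdiff yA) ?_
    refine lt_of_le_of_lt (dist_liftA_liftA_le_ps g hpos c x x' yA) ?_
    linarith
  have hBr₂ : |rescaledCorrelator (criticalCorr 3) rhoPin (a + a) δ Z₃ -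
      rescaledCorrelator (criticalCorr 3) rhoPin (a + a) δ Z₄| < ε₁ := by
    refine hE₁k Z₃ hm₃ Z₄ hm₄ (liftA_eq_of_ne_ps g δ c hdiff yA') ?_
    refine lt_of_le_of_lt (dist_liftA_liftA_le_ps g hpos c x x' yA') ?_
    linarith
  have hS : |rescaledCorrelator (criticalCorr 3) rhoPin (b + b) δ ZB| ≤ M := hLBk ZB hmB
  -- conclusion
  set P := (rescaledCorrelator (criticalCorr 3) rhoPin (a + a) δ Z₁ -
      rescaledCorrelator (criticalCorr 3) rhoPin (a + a) δ Z₂) -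
    (rescaledCorrelator (criticalCorr 3) rhoPin (a + a) δ Z₃ -
      rescaledCorrelator (criticalCorr 3) rhoPin (a + a) δ Z₄) with hP
  set Q := rescaledCorrelator (criticalCorr 3) rhoPin (b + b) δ ZB with hQ
  have hPabs : |P| < 2 * ε₁ := (abs_sub _ _).trans_lt (by linarith)
  have hPQ : P * Q ≤ 2 * ε₁ * M := by
    refine (le_abs_self _).trans ?_
    rw [abs_mul]
    refine (mul_le_mul_of_nonneg_right hPabs.le (abs_nonneg _)).trans ?_
    exact mul_le_mul_of_nonneg_left hS (by positivity)
  have hMε : 2 * ε₁ * M < ε ^ 2 := by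
    have hM2 : 0 < 2 * |M| + 2 := by positivity
    have hle : 2 * ε₁ * M ≤ 2 * ε₁ * |M| := mul_le_mul_of_nonneg_left (le_abs_self M) (by positivity)
    have heq : 2 * ε₁ * |M| = ε ^ 2 * (2 * |M|) / (2 * |M| + 2) := by rw [hε₁]; ring
    have hlt : ε ^ 2 * (2 * |M|) / (2 * |M| + 2) < ε ^ 2 := by
      rw [div_lt_iff₀ hM2]
      nlinarith [pow_pos hε 2]
    linarith
  have hsq : (rescaledCorrelator (criticalCorr 3) rhoPin (a + b) δ x -
      rescaledCorrelator (criticalCorr 3) rhoPin (a + b) δ x') ^ 2 < ε ^ 2 :=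
    lt_of_le_of_lt (key.trans hPQ) hMε
  exact abs_lt_of_sq_lt_sq hsq hε.le

end Summit.CriticalPhenomena.Ising3DConformalLimit.MoebiusLimitExistsOnlyInteraction

end
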